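import Literature.Computability.MetaComplexity.DepthFregeOfResolutionWidth
import HarnessLib

/-!
# The lines of a resolution refutation as short bounded sequent derivations

Topic `Literature/Computability/MetaComplexity`. First half of the structural (polynomial)
simulation of resolution by bounded-depth `textbookFrege` (`DepthFregeSimulatesResolution.lean`):
for each kind of line of a resolution refutation — initial clause, weakening `C ⊆ E`, resolvent
`E` of `C ∋ v` and `D ∋ ¬v` — a bounded derivation (`TextbookFrege.BD`, `FregeBounded.lean`) of the
three-member sequent `⊢ K_E, ¬K_C, ¬K_D` (`K_X` the clause formula of `X`) with a number of lines
POLYNOMIAL in the width: flatten the premises into their literal formulas, cut once on the pivot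
variable, and fold the literals of `E` back into one disjunction.

* `unflattenS` — fold a run of members of a sequent back into one disjunction member;
* `clauseLitsS` — `⊢ (literals of c)ʳᵉᵛ, ¬clauseOf c`;
* `LF C`, `KF C` — literal formulas / clause formula of a set-clause; `foldIntoS`;
* `initialSeqS`, `weakenSeqS`, `resolventSeqS` — the three sequents, `seqCost w N` lines.

[folklore] (Krajíček, *Proof complexity*, CUP 2019, Lemma 3.2.1 — clauses as sequents — and
§5.1; Shoenfield 1967, §3.1 for the structural rules).
-/

namespace Literature.Computability.MetaComplexity

open Complexity Complexity.PropForm TextbookFrege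
open KrajicekRamsey (litOf dd_litOf_le dd_clauseOf_le)

namespace TextbookFrege

variable {D B : ℕ}

/-! ### Folding members into a disjunction -/

/-- **Unflattening**: from `⊢ Ps ++ L` derive `⊢ (⋁Ps) :: L` (the members of `Ps` folded back
into one disjunction member), by induction on `Ps`: reorder, fold the tail, reorder, `consDisjS`.
[Shoenfield 1967, §3.1] [folklore] -/
theorem unflattenS (Ps : List (PropForm ℕ)) {L : List (PropForm ℕ)} {ℓ p N S : ℕ}
    (h : BD D B ℓ (disjList (Ps ++ L))) (hp : ∀ X ∈ Ps ++ L, X.dd ≤ p) (hD : p + 4 ≤ D)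
    (hN : Ps.length + L.length + 2 ≤ N) (hS : msum (Ps ++ L) ≤ S) (hs : 12 * S + 40 ≤ B) :
    BD D B (ℓ + (Ps.length + 1) * (100 * (N + 1) ^ 2 + 1)) (disjList (disjList Ps :: L)) := by
  induction Ps generalizing L ℓ with
  | nil =>
    simp only [List.nil_append] at h hp hS
    have hctx : ∀ X ∈ disjList [] :: L, X.dd ≤ p := by
      intro X hX
      rcases List.mem_cons.1 hX with rfl | hX
      · simp
      · exact hp X hX
    refine (subsetN (N := N) h (fun A hA => List.mem_cons_of_mem _ hA) hctx hD ?_ (by simp at hN ⊢; omega)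
      (by simp at hN ⊢; omega)).mono (by nlinarith)
    have e1 : (disjList L).size = msum L + 1 := size_disjList_eq_msum L
    have e2 : (disjList (disjList [] :: L)).size = msum L + 1 + 1 + 1 := by
      rw [size_disjList_cons, size_disjList_nil, e1]; omega
    rw [e1, e2]
    omega
  | cons q Ps ih =>
    -- (1) move `q` behind `Ps`
    have hsub1 : ∀ A ∈ q :: (Ps ++ L), A ∈ Ps ++ (q :: L) := by
      intro A hA
      simp only [List.mem_cons, List.mem_append] at hA ⊢
      tauto
    have hp1 : ∀ X ∈ Ps ++ (q :: L), X.dd ≤ p := fun X hX => hp X (by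
      simp only [List.cons_append, List.mem_cons, List.mem_append] at hX ⊢; tauto)
    have hS1 : msum (Ps ++ (q :: L)) ≤ S := by
      have : msum (Ps ++ (q :: L)) = msum (q :: Ps ++ L) := by
        simp only [msum_append, msum_cons, List.cons_append]; omega
      rw [this]; exact hS
    have s1 : BD D B (ℓ + 50 * (N + 1) ^ 2) (disjList (Ps ++ (q :: L))) :=
      subsetN (N := N) h hsub1 hp1 hD (by
        simp only [size_disjList_eq_msum]
        have e : msum (q :: Ps ++ L) = msum (q :: (Ps ++ L)) := rfl
        simp only [List.cons_append] at hS
        have := hS1; omega) (by simp at hN ⊢; omega) (by simp at hN ⊢; omega)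
    -- (2) fold the tail
    have s2 := ih s1 hp1 (by simp at hN ⊢; omega) hS1
    -- (3) move `q` to the front and fold it in
    have hpq : q.dd ≤ p := hp q (by simp)
    have hPs : (disjList Ps).dd ≤ p := dd_disjList_le fun A hA => hp1 A (List.mem_append_left _ hA)
    have hctx : ∀ X ∈ q :: disjList Ps :: L, X.dd ≤ p := by
      intro X hX
      simp only [List.mem_cons] at hX
      rcases hX with rfl | rfl | hX
      · exact hpq
      · exact hPs
      · exact hp1 X (List.mem_append_right _ (List.mem_cons_of_mem _ hX))
    have hmsPs : msum Ps + msum L + q.size + 1 ≤ S := by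
      have e : msum (Ps ++ (q :: L)) = msum Ps + (q.size + 1 + msum L) := by rw [msum_append, msum_cons]
      rw [e] at hS1
      omega
    have s3 : BD D B (ℓ + 50 * (N + 1) ^ 2 + (Ps.length + 1) * (100 * (N + 1) ^ 2 + 1) + 50 * (N + 1) ^ 2)
        (disjList (q :: disjList Ps :: L)) :=
      subsetN (N := N) s2 (by
          intro A hA; simp only [List.mem_cons] at hA ⊢; tauto) hctx hD (by
          simp only [size_disjList_eq_msum, msum_cons]
          omega) (by simp at hN ⊢; omega) (by simp at hN ⊢; omega)
    have s4 := consDisjS s3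
    refine s4.mono ?_
    simp only [List.length_cons]
    nlinarith

/-! ### The literals of a clause against its negated formula -/

/-- Size of the list of literal formulas of a clause. [folklore] -/
theorem msum_map_litOf_le (c : Clause ℕ) : msum (c.map litOf) ≤ 3 * c.length := by
  induction c with
  | nil => simp
  | cons l c ih =>
    rw [List.map_cons, msum_cons, List.length_cons]
    have := TextbookFrege.size_litOf_le l
    omega

/-- **`⊢ (literals of c)ʳᵉᵛ, ¬clauseOf c`**: the axiom `⊢ ¬K, K` with `K = clauseOf c` flattened
into the literal formulas of `c`. [Shoenfield 1967, §3.1] [folklore] -/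
theorem clauseLitsS (c : Clause ℕ) {w N : ℕ} (hc : c.length ≤ w) (hD : 8 ≤ D)
    (hN : w + 4 ≤ N) (hs : 40 * w + 60 ≤ B) :
    BD D B (12 + 50 * (N + 1) ^ 2 + w * (50 * (N + 1) ^ 2 + 8) + 6)
      (disjList ((c.map litOf).reverse ++ [neg (KrajicekRamsey.clauseOf c)])) := by
  set K := KrajicekRamsey.clauseOf c with hK
  have hKsize : K.size ≤ 3 * w + 1 := (OntoPHPReduction.size_clauseOf_le c).trans (by omega)
  have hKdd : K.dd ≤ 1 := dd_clauseOf_le c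
  have hK1 := altDepthAux_le_dd_succ 1 K
  have hnKdd : (neg K).dd ≤ 3 := by rw [dd_neg]; omega
  have ax : BD D B 12 (disjList [neg K, K]) := axS K (by omega) (by omega)
  have ax' : BD D B (12 + 50 * (N + 1) ^ 2) (disjList [K, neg K]) :=
    subsetN (N := N) ax (by intro X hX; simp only [List.mem_cons, List.not_mem_nil, or_false] at hX ⊢; tauto)
      (p := 3) (by
        intro X hX; simp only [List.mem_cons, List.not_mem_nil, or_false] at hX
        rcases hX with rfl | rfl <;> omega) (by omega)
      (by simp only [size_disjList_cons, size_disjList_nil, size]; omega) (by simp; omega) (by simp; omega)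
  have e : disjList [K, neg K] = disjList (disjList (c.map litOf) :: [neg K]) := rfl
  rw [e] at ax'
  have hp : ∀ X ∈ c.map litOf ++ [neg K], X.dd ≤ 3 := by
    intro X hX
    rcases List.mem_append.1 hX with hX | hX
    · obtain ⟨l, -, rfl⟩ := List.mem_map.1 hX
      exact (dd_litOf_le l).trans (by norm_num)
    · simp only [List.mem_singleton] at hX; rw [hX]; exact hnKdd
  have hms := msum_map_litOf_le c
  have f := flattenAuxS (c.map litOf) ax' hp (by omega) (N := N) (by simp; omega)
    (by simp only [msum_append, msum_cons, msum_nil, size]; omega)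
  refine f.mono ?_
  rw [List.length_map]
  have : c.length * (50 * (N + 1) ^ 2 + 8) ≤ w * (50 * (N + 1) ^ 2 + 8) := Nat.mul_le_mul_right _ hc
  omega

/-! ### The three-member sequents of the lines of a resolution refutation -/

/-- The literal formulas of a set-clause. [folklore] -/
noncomputable def LF (C : Finset (Literal ℕ)) : List (PropForm ℕ) := C.toList.map litOf

/-- The clause formula of a set-clause (`⋁ LF C`). [folklore] -/
noncomputable def KF (C : Finset (Literal ℕ)) : PropForm ℕ := KrajicekRamsey.clauseOf C.toList

/-- `KF C = ⋁ (LF C)`. [folklore] -/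
theorem KF_eq (C : Finset (Literal ℕ)) : KF C = disjList (LF C) := rfl

/-- Members of `LF`. [folklore] -/
theorem mem_LF {C : Finset (Literal ℕ)} {X : PropForm ℕ} : X ∈ LF C ↔ ∃ l ∈ C, X = litOf l := by
  simp only [LF, List.mem_map, Finset.mem_toList]
  exact ⟨fun ⟨l, hl, h⟩ => ⟨l, hl, h.symm⟩, fun ⟨l, hl, h⟩ => ⟨l, hl, h.symm⟩⟩

/-- `litOf l ∈ LF C` for `l ∈ C`. [folklore] -/
theorem litOf_mem_LF {C : Finset (Literal ℕ)} {l : Literal ℕ} (hl : l ∈ C) : litOf l ∈ LF C :=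
  mem_LF.2 ⟨l, hl, rfl⟩

/-- Length of `LF`. [folklore] -/
theorem length_LF (C : Finset (Literal ℕ)) : (LF C).length = C.card := by
  simp [LF]

/-- Size of `LF`. [folklore] -/
theorem msum_LF_le (C : Finset (Literal ℕ)) : msum (LF C) ≤ 3 * C.card := by
  have := msum_map_litOf_le C.toList
  rwa [Finset.length_toList] at this

/-- Disjunct depth of members of `LF`. [folklore] -/
theorem dd_of_mem_LF {C : Finset (Literal ℕ)} {X : PropForm ℕ} (hX : X ∈ LF C) : X.dd ≤ 1 := by
  obtain ⟨l, -, rfl⟩ := mem_LF.1 hX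
  exact dd_litOf_le l

/-- Size of `KF`. [folklore] -/
theorem size_KF_le {C : Finset (Literal ℕ)} {w : ℕ} (hC : C.card ≤ w) : (KF C).size ≤ 3 * w + 1 :=
  (OntoPHPReduction.size_clauseOf_le C.toList).trans (by rw [Finset.length_toList]; omega)

/-- Disjunct depth of `¬ KF C`. [folklore] -/
theorem dd_neg_KF_le (C : Finset (Literal ℕ)) : (neg (KF C)).dd ≤ 3 := by
  have h1 := dd_clauseOf_le C.toList
  have h2 := altDepthAux_le_dd_succ 1 (KF C)
  rw [dd_neg]; unfold KF at *; omega

/-- The line cost of the three-member sequents. [folklore] -/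
def seqCost (w N : ℕ) : ℕ := (w + 2) * (200 * (N + 1) ^ 2 + 20)

/-- The common endgame: from `⊢ (LF C)ʳᵉᵛ ++ [¬K]` (literals of `C`, all in `E`), weaken into the
context `LF E ++ [¬K, ¬K']` and fold: `⊢ KF E, ¬K, ¬K'`. [folklore] -/
theorem foldIntoS {C E : Finset (Literal ℕ)} {K K' : PropForm ℕ} {w N ℓ : ℕ}
    (hCE : C ⊆ E) (hE : E.card ≤ w) (hK : K.size ≤ 3 * w + 1) (hK' : K'.size ≤ 3 * w + 1)
    (hKdd : (neg K).dd ≤ 3) (hK'dd : (neg K').dd ≤ 3)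
    (h : BD D B ℓ (disjList (LF E ++ [neg K, neg K']))) (hD : 8 ≤ D) (hN : w + 6 ≤ N)
    (hs : 200 * (w + 1) ≤ B) :
    BD D B (ℓ + (w + 1) * (100 * (N + 1) ^ 2 + 1)) (disjList [KF E, neg K, neg K']) := by
  have _ := hCE
  have hp : ∀ X ∈ LF E ++ [neg K, neg K'], X.dd ≤ 3 := by
    intro X hX
    rcases List.mem_append.1 hX with hX | hX
    · exact (dd_of_mem_LF hX).trans (by norm_num)
    · simp only [List.mem_cons, List.not_mem_nil, or_false] at hX
      rcases hX with rfl | rfl <;> assumption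
  have hms := msum_LF_le E
  have u := unflattenS (LF E) h hp (by omega) (N := N) (by rw [length_LF]; simp; omega)
    (S := 9 * w + 8) (by simp only [msum_append, msum_cons, msum_nil, size]; omega) (by omega)
  rw [← KF_eq] at u
  refine u.mono ?_
  rw [length_LF]
  have : (E.card + 1) * (100 * (N + 1) ^ 2 + 1) ≤ (w + 1) * (100 * (N + 1) ^ 2 + 1) :=
    Nat.mul_le_mul_right _ (by omega)
  omega

/-- **The sequent of an initial line**: `⊢ KF c.toFinset, ¬clauseOf c, ¬clauseOf c` for a
clause `c` of width `≤ w`. [folklore] -/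
theorem initialSeqS (c : Clause ℕ) {w N : ℕ} (hc : c.length ≤ w) (hD : 8 ≤ D) (hN : w + 6 ≤ N)
    (hs : 200 * (w + 1) ≤ B) :
    BD D B (seqCost w N)
      (disjList [KF c.toFinset, neg (KrajicekRamsey.clauseOf c), neg (KrajicekRamsey.clauseOf c)]) := by
  have hKsize : (KrajicekRamsey.clauseOf c).size ≤ 3 * w + 1 :=
    (OntoPHPReduction.size_clauseOf_le c).trans (by omega)
  have hKdd : (neg (KrajicekRamsey.clauseOf c)).dd ≤ 3 := by
    have h1 : (KrajicekRamsey.clauseOf c).dd ≤ 1 := dd_clauseOf_le c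
    have h2 := altDepthAux_le_dd_succ 1 (KrajicekRamsey.clauseOf c)
    rw [dd_neg]; omega
  have hEw : c.toFinset.card ≤ w := (List.toFinset_card_le c).trans hc
  have s1 := clauseLitsS (D := D) (B := B) c hc hD (N := N) (by omega) (by omega)
  -- weaken into the context
  have hctx : ∀ X ∈ LF c.toFinset ++ [neg (KrajicekRamsey.clauseOf c), neg (KrajicekRamsey.clauseOf c)], X.dd ≤ 3 := by
    intro X hX
    rcases List.mem_append.1 hX with hX | hX
    · exact (dd_of_mem_LF hX).trans (by norm_num)
    · simp only [List.mem_cons, List.not_mem_nil, or_false] at hX; rcases hX with rfl | rfl <;> exact hKdd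
  have hsub : ∀ X ∈ (c.map litOf).reverse ++ [neg (KrajicekRamsey.clauseOf c)], X ∈ LF c.toFinset ++ [neg (KrajicekRamsey.clauseOf c), neg (KrajicekRamsey.clauseOf c)] := by
    intro X hX
    rcases List.mem_append.1 hX with hX | hX
    · obtain ⟨l, hl, rfl⟩ := List.mem_map.1 (List.mem_reverse.1 hX)
      exact List.mem_append_left _ (litOf_mem_LF (List.mem_toFinset.2 hl))
    · simp only [List.mem_singleton] at hX
      exact List.mem_append_right _ (by simp [hX])
  have hms1 := msum_map_litOf_le c
  have hms2 := msum_LF_le c.toFinset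
  have s2 := subsetN (N := N) s1 hsub hctx (by omega) (by
    simp only [size_disjList_eq_msum, msum_append, msum_reverse, msum_cons, msum_nil, size]; omega)
    (by simp; omega) (by rw [List.length_append, length_LF]; simp; omega)
  have f := foldIntoS (subset_refl _) hEw hKsize hKsize hKdd hKdd s2 hD hN hs
  refine f.mono ?_
  unfold seqCost
  nlinarith

/-- **The sequent of a weakening line**: `⊢ KF E, ¬KF C, ¬KF C` for `C ⊆ E`. [folklore] -/
theorem weakenSeqS {C E : Finset (Literal ℕ)} (hCE : C ⊆ E) {w N : ℕ} (hC : C.card ≤ w)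
    (hE : E.card ≤ w) (hD : 8 ≤ D) (hN : w + 6 ≤ N) (hs : 200 * (w + 1) ≤ B) :
    BD D B (seqCost w N) (disjList [KF E, neg (KF C), neg (KF C)]) := by
  have hCl : C.toList.length ≤ w := by rw [Finset.length_toList]; exact hC
  have s1 := clauseLitsS (D := D) (B := B) C.toList hCl hD (N := N) (by omega) (by omega)
  have hKdd := dd_neg_KF_le C
  have hctx : ∀ X ∈ LF E ++ [neg (KF C), neg (KF C)], X.dd ≤ 3 := by
    intro X hX
    rcases List.mem_append.1 hX with hX | hX
    · exact (dd_of_mem_LF hX).trans (by norm_num)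
    · simp only [List.mem_cons, List.not_mem_nil, or_false] at hX; rcases hX with rfl | rfl <;> exact hKdd
  have hsub : ∀ X ∈ (C.toList.map litOf).reverse ++ [neg (KrajicekRamsey.clauseOf C.toList)],
      X ∈ LF E ++ [neg (KF C), neg (KF C)] := by
    intro X hX
    rcases List.mem_append.1 hX with hX | hX
    · obtain ⟨l, hl, rfl⟩ := List.mem_map.1 (List.mem_reverse.1 hX)
      exact List.mem_append_left _ (litOf_mem_LF (hCE (Finset.mem_toList.1 hl)))
    · simp only [List.mem_singleton] at hX
      exact List.mem_append_right _ (by simp [hX, KF])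
  have hms1 := msum_LF_le C
  have hms2 := msum_LF_le E
  have hKs := size_KF_le hC
  have s2 := subsetN (N := N) s1 hsub hctx (by omega) (by
    simp only [size_disjList_eq_msum, msum_append, msum_reverse, msum_cons, msum_nil, size]
    unfold LF KF at *; omega)
    (by simp; omega) (by rw [List.length_append, length_LF]; simp; omega)
  have f := foldIntoS hCE hE hKs hKs hKdd hKdd s2 hD hN hs
  refine f.mono ?_
  unfold seqCost
  nlinarith

/-- **The sequent of a resolution line**: `⊢ KF E, ¬KF C, ¬KF D` for the resolvent `E` of
`C ∋ v` and `D ∋ ¬v`: flatten both premises, move the pivot literal to the front, cut once on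
`var v`, fold the literals of `E`. [cite: KrajicekProofComplexity2019, §5.1 (the resolution rule) and Lemma 3.2.1 (clauses as sequents)] -/
theorem resolventSeqS {C Dc E : Finset (Literal ℕ)} {v : ℕ} (hres : IsResolvent C Dc v E) {w N : ℕ}
    (hC : C.card ≤ w) (hDc : Dc.card ≤ w) (hE : E.card ≤ w) (hD : 8 ≤ D) (hN : w + 6 ≤ N)
    (hs : 200 * (w + 1) ≤ B) :
    BD D B (seqCost w N) (disjList [KF E, neg (KF C), neg (KF Dc)]) := by
  obtain ⟨hvC, hvD, hEeq⟩ := hres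
  have hCl : C.toList.length ≤ w := by rw [Finset.length_toList]; exact hC
  have hDl : Dc.toList.length ≤ w := by rw [Finset.length_toList]; exact hDc
  have s1 := clauseLitsS (D := D) (B := B) C.toList hCl hD (N := N) (by omega) (by omega)
  have s2 := clauseLitsS (D := D) (B := B) Dc.toList hDl hD (N := N) (by omega) (by omega)
  have hKCdd := dd_neg_KF_le C
  have hKDdd := dd_neg_KF_le Dc
  have hKCs := size_KF_le hC
  have hKDs := size_KF_le hDc
  have hmsC := msum_LF_le C
  have hmsD := msum_LF_le Dc
  have hmsE := msum_LF_le E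
  -- membership of the literals of the premises
  have hmemE : ∀ l, (l ∈ C ∧ l ≠ (v, true)) ∨ (l ∈ Dc ∧ l ≠ (v, false)) → l ∈ E := by
    rintro l (⟨hl, hne⟩ | ⟨hl, hne⟩)
    · rw [hEeq]; exact Finset.mem_union_left _ (Finset.mem_erase.2 ⟨hne, hl⟩)
    · rw [hEeq]; exact Finset.mem_union_right _ (Finset.mem_erase.2 ⟨hne, hl⟩)
  set Γ := LF E ++ [neg (KF C), neg (KF Dc)] with hΓ
  have hctx : ∀ A : PropForm ℕ, A.dd ≤ 3 → ∀ X ∈ A :: Γ, X.dd ≤ 3 := by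
    intro A hA X hX
    rcases List.mem_cons.1 hX with rfl | hX
    · exact hA
    · rcases List.mem_append.1 hX with hX | hX
      · exact (dd_of_mem_LF hX).trans (by norm_num)
      · simp only [List.mem_cons, List.not_mem_nil, or_false] at hX
        rcases hX with rfl | rfl <;> assumption
  have hsub1 : ∀ X ∈ (C.toList.map litOf).reverse ++ [neg (KrajicekRamsey.clauseOf C.toList)],
      X ∈ var v :: Γ := by
    intro X hX
    rcases List.mem_append.1 hX with hX | hX
    · obtain ⟨l, hl, rfl⟩ := List.mem_map.1 (List.mem_reverse.1 hX)
      have hlC := Finset.mem_toList.1 hl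
      by_cases hlv : l = (v, true)
      · subst hlv; simp [litOf]
      · exact List.mem_cons_of_mem _ (List.mem_append_left _ (litOf_mem_LF (hmemE l (Or.inl ⟨hlC, hlv⟩))))
    · simp only [List.mem_singleton] at hX
      exact List.mem_cons_of_mem _ (List.mem_append_right _ (by simp [hX, KF]))
  have hsub2 : ∀ X ∈ (Dc.toList.map litOf).reverse ++ [neg (KrajicekRamsey.clauseOf Dc.toList)],
      X ∈ neg (var v) :: Γ := by
    intro X hX
    rcases List.mem_append.1 hX with hX | hX
    · obtain ⟨l, hl, rfl⟩ := List.mem_map.1 (List.mem_reverse.1 hX)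
      have hlD := Finset.mem_toList.1 hl
      by_cases hlv : l = (v, false)
      · subst hlv; simp [litOf]
      · exact List.mem_cons_of_mem _ (List.mem_append_left _ (litOf_mem_LF (hmemE l (Or.inr ⟨hlD, hlv⟩))))
    · simp only [List.mem_singleton] at hX
      exact List.mem_cons_of_mem _ (List.mem_append_right _ (by simp [hX, KF]))
  have hlenΓ : Γ.length ≤ w + 2 := by rw [hΓ, List.length_append, length_LF]; simp; omega
  have hmsΓ : msum Γ ≤ 9 * w + 8 := by
    rw [hΓ, msum_append]; simp only [msum_cons, msum_nil, size]; unfold KF LF at *; omega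
  have t1 : BD D B (12 + 50 * (N + 1) ^ 2 + w * (50 * (N + 1) ^ 2 + 8) + 6 + 50 * (N + 1) ^ 2)
      (disjList (var v :: Γ)) :=
    subsetN (N := N) s1 hsub1 (hctx (var v) (by simp)) (by omega) (by
      simp only [size_disjList_eq_msum, msum_append, msum_reverse, msum_cons, msum_nil, size]
      have := msum_map_litOf_le C.toList; rw [Finset.length_toList] at this
      unfold KF LF at *; omega)
      (by simp; omega) (by simp only [List.length_cons]; omega)
  have t2 : BD D B (12 + 50 * (N + 1) ^ 2 + w * (50 * (N + 1) ^ 2 + 8) + 6 + 50 * (N + 1) ^ 2)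
      (disjList (neg (var v) :: Γ)) :=
    subsetN (N := N) s2 hsub2 (hctx (neg (var v)) (by simp)) (by omega) (by
      simp only [size_disjList_eq_msum, msum_append, msum_reverse, msum_cons, msum_nil, size]
      have := msum_map_litOf_le Dc.toList; rw [Finset.length_toList] at this
      unfold KF LF at *; omega)
      (by simp; omega) (by simp only [List.length_cons]; omega)
  have c := cutS t1 t2 (by rw [size_disjList_eq_msum]; omega)
  rw [hΓ] at c
  have f := foldIntoS (subset_refl _) hE hKCs hKDs hKCdd hKDdd c hD hN hs
  refine f.mono ?_
  unfold seqCost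
  nlinarith

end TextbookFrege

end Literature.Computability.MetaComplexity
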